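import Literature.AnabelianGeometry.EtaleTheta.Discharge.Sec1ThetaCompanionOfAut
import HarnessLib

/-!
# The completed automorphism `α̂` of `Π_X`: functoriality, involutions, and compatibility with the
# augmentation `Π_X → G_{ℚ_p}` (generic plumbing for the [EtTh] §2 inversion `ι` of `C = X/{±1}`)

S. Mochizuki, *The étale theta function and its Frobenioid-theoretic manifestations*, Publ. RIMS **45**
(2009) [EtTh], §2 p. 36 (printed 262): «`ι` for the automorphism of order two … `C^log` … the stack-theoretic
quotient of `X^log` by the action of `ι`», «`1 → Δ_C → Π_C → G_K → 1`»; [SemiAnbd] §6 p. 69 «natural injection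
`Π^tp ↪ Π`» (dense image, universal property) [cite: MochizukiEtTh2009, §2 p.36].

Cell abc-iut, layer L2, seat abc-iut-L2-t10 (gen 5). PROOF-ONLY (0 definitions), generic over
`X : TemperedCurve p` and topological automorphisms `α, β : Π^tp_X ≃ₜ* Π^tp_X` (abc-iut-L2-t1's
`TemperedCurve.completionAut`, `Discharge/Sec1ThetaCompanionOfAut`). To put a profinite `Π_C := Π_X ⋊_{ι̂} ℤ/2`
over a model (`SettingModelChiPiC` at stage 1; the same at abc-iut-w5-d249's stage-2 carrier with the
cocycle-corrected `inversionχq`, whose completion has no closed formula) one needs exactly: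

* `completionAut_trans_apply`: `(α ≫ β)^ = β̂ ∘ α̂` (uniqueness of extensions along the dense `ι_X`);
  `completionAut_refl_apply`: `(id)^ = id`;
* **`completionAut_completionAut_of_involutive`**: if `α (α x) = x` on `Π^tp_X` then `α̂ (α̂ z) = z` on `Π_X`
  (so `ℤ/2 → Aut(Π_X)`, generator `↦ α̂`, is well defined: `completionAut_mul_completionAut_of_involutive`);
* **`augHat_completionAut_of_aug`**: if `α` is OVER `G_{ℚ_p}` (`aug (α x) = aug x`) then so is `α̂`
  (`augHat (α̂ z) = augHat z`) — the augmentation `Π_X ⋊_{α̂} ℤ/2 → G_K`, `(z, ε) ↦ augHat z`, is then a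
  homomorphism (`SemidirectProduct.lift augHat 1`).

Nothing of [EtTh] is asserted; no side is taken on [IUTchIII] Cor. 3.12; typed ≠ proved.
-/

noncomputable section

namespace Literature.AnabelianGeometry.SemiGraphs

namespace TemperedCurve

open _root_.Topology

variable {p : ℕ} [Fact p.Prime] (X : TemperedCurve p) (α β : X.PiTemp ≃ₜ* X.PiTemp)

/-- Two continuous maps `Π_X → Y` into a Hausdorff space that agree on `ι_X(Π^tp_X)` are equal (density).
[cite: MochizukiSemiAnbd2006, §6 p.69] -/
theorem ext_on_toHat {Y : Type*} [TopologicalSpace Y] [T2Space Y] {f g : X.PiHat → Y} (hf : Continuous f)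
    (hg : Continuous g) (h : ∀ x : X.PiTemp, f (X.toHat x) = g (X.toHat x)) : f = g :=
  Continuous.ext_on X.isProfiniteCompletion_toHat.denseRange hf hg fun _ ⟨x, hx⟩ => by subst hx; exact h x

/-- **Functoriality**: `(α ≫ β)^ z = β̂ (α̂ z)`. [cite: MochizukiSemiAnbd2006, §6 p.69] -/
theorem completionAut_trans_apply (z : X.PiHat) :
    X.completionAut (α.trans β) z = X.completionAut β (X.completionAut α z) := by
  haveI : T2Space X.PiHat := X.isProfiniteCompletion_toHat.t2Space
  have h := X.ext_on_toHat (X.completionAut (α.trans β)).continuous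
    ((X.completionAut β).continuous.comp (X.completionAut α).continuous) fun x => by
      change X.completionAut (α.trans β) (X.toHat x) = X.completionAut β (X.completionAut α (X.toHat x))
      rw [completionAut_toHat, completionAut_toHat, completionAut_toHat]
      rfl
  exact congrFun h z

/-- `(id)^ = id`. [cite: MochizukiSemiAnbd2006, §6 p.69] -/
theorem completionAut_refl_apply (z : X.PiHat) : X.completionAut (ContinuousMulEquiv.refl X.PiTemp) z = z := by
  haveI : T2Space X.PiHat := X.isProfiniteCompletion_toHat.t2Space
  have h := X.ext_on_toHat (X.completionAut (ContinuousMulEquiv.refl X.PiTemp)).continuous continuous_id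
    fun x => by
      change X.completionAut (ContinuousMulEquiv.refl X.PiTemp) (X.toHat x) = X.toHat x
      rw [completionAut_toHat]
      rfl
  exact congrFun h z

/-- **The completion of an involution is an involution**: `α (α x) = x` on `Π^tp_X` ⇒ `α̂ (α̂ z) = z` on `Π_X`.
[cite: MochizukiEtTh2009, §2 p.36] -/
theorem completionAut_completionAut_of_involutive (hα : ∀ x, α (α x) = x) (z : X.PiHat) :
    X.completionAut α (X.completionAut α z) = z := by
  haveI : T2Space X.PiHat := X.isProfiniteCompletion_toHat.t2Space
  have h := X.ext_on_toHat ((X.completionAut α).continuous.comp (X.completionAut α).continuous) continuous_id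
    fun x => by
      change X.completionAut α (X.completionAut α (X.toHat x)) = X.toHat x
      rw [completionAut_toHat, completionAut_toHat, hα]
  exact congrFun h z

/-- Hence `α̂ · α̂ = 1` in `Aut(Π_X)`. [cite: MochizukiEtTh2009, §2 p.36] -/
theorem completionAut_mul_completionAut_of_involutive (hα : ∀ x, α (α x) = x) :
    (X.completionAut α).toMulEquiv * (X.completionAut α).toMulEquiv = 1 :=
  MulEquiv.ext fun z => X.completionAut_completionAut_of_involutive α hα z

/-- `α̂` equals its own inverse for an involution `α`. [cite: MochizukiEtTh2009, §2 p.36] -/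
theorem completionAut_symm_apply_of_involutive (hα : ∀ x, α (α x) = x) (z : X.PiHat) :
    (X.completionAut α).symm z = X.completionAut α z := by
  apply (X.completionAut α).injective
  rw [ContinuousMulEquiv.apply_symm_apply, X.completionAut_completionAut_of_involutive α hα]

/-- **An automorphism OVER `G_{ℚ_p}` completes to one over `G_{ℚ_p}`**: `aug (α x) = aug x` for all `x ∈ Π^tp_X`
⇒ `augHat (α̂ z) = augHat z` for all `z ∈ Π_X` (both sides continuous into the Hausdorff `G_{ℚ_p}`, equal on the
dense `ι_X(Π^tp_X)` by `augHat ∘ ι_X = aug`). [cite: MochizukiEtTh2009, §2 p.36] -/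
theorem augHat_completionAut_of_aug (hα : ∀ x, X.aug (α x) = X.aug x) (z : X.PiHat) :
    X.augHat (X.completionAut α z) = X.augHat z := by
  haveI : T2Space (GQp p) := krullTopology_t2
  have h := X.ext_on_toHat (X.augHat.continuous.comp (X.completionAut α).continuous) X.augHat.continuous
    fun x => by
      change X.augHat (X.completionAut α (X.toHat x)) = X.augHat (X.toHat x)
      rw [completionAut_toHat, X.augHat_comp, X.augHat_comp, hα]
  exact congrFun h z

/-- Consequently `α̂` carries `Ker(Π_X → G_{ℚ_p})` to itself. [cite: MochizukiEtTh2009, §2 p.36] -/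
theorem completionAut_mem_ker_augHat_iff (hα : ∀ x, X.aug (α x) = X.aug x) (z : X.PiHat) :
    X.completionAut α z ∈ X.augHat.toMonoidHom.ker ↔ z ∈ X.augHat.toMonoidHom.ker := by
  rw [MonoidHom.mem_ker, MonoidHom.mem_ker]
  change X.augHat (X.completionAut α z) = 1 ↔ X.augHat z = 1
  rw [X.augHat_completionAut_of_aug α hα]

/-- `augHat ∘ α̂ = augHat` in the `MonoidHom.comp` form that `SemidirectProduct.lift augHat 1` requires for a
`ℤ/2`-action through `α̂` (trivial second component). [cite: MochizukiEtTh2009, §2 p.36] -/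
theorem augHat_comp_completionAut_of_aug (hα : ∀ x, X.aug (α x) = X.aug x) :
    X.augHat.toMonoidHom.comp (X.completionAut α).toMulEquiv.toMonoidHom = X.augHat.toMonoidHom :=
  MonoidHom.ext fun z => X.augHat_completionAut_of_aug α hα z

end TemperedCurve

end Literature.AnabelianGeometry.SemiGraphs

end
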